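import Literature.AnabelianGeometry.EtaleTheta.Discharge.Sec5ConstantUnitNthRoot
import Literature.AnabelianGeometry.EtaleTheta.Discharge.Sec4RootTwistLaws
import Literature.AnabelianGeometry.EtaleTheta.Discharge.Sec5ConstEmbOfTerminal

/-!
# [EtTh] Thm 5.7 / Lemma 5.8 / Def 4.1 (iii): the binder `hroot₁N` (with its `hfix` clause) of the Thm 5.7 closer —
# EXACT POINTWISE RESIDUAL, and the constant case DISCHARGED (pp. 329–331 / PDF pp. 103–105; p.313 / PDF p.87)

S. Mochizuki, *The étale theta function and its Frobenioid-theoretic manifestations*, Publ. RIMS **45** (2009)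
[cite: MochizukiEtTh2009, Thm 5.7 p.329–330 (PDF pp.103–104); Lem 5.8 p.331 (PDF p.105); Def 4.1 (iii) p.313 (PDF p.87);
Def 3.6 (iii) p.303 (PDF p.77); §1 p.240 (PDF p.14)]; S. Mochizuki, *The geometry of Frobenioids I*, [FrdI] Thm. 5.2 (i)(ii)
pp.100–101 (the model Frobenioid; `O^×(−)` on `C^birat` is `B`).

abc-iut cell, layer L2, row «`hroot₁N`/`hfix` [f-123]» of the EtTh:Thm5.7 census (abc-iut-L2-lead ROWS #37 R415 / #39 R431;
seat abc-iut-f-123 gen 4).  PROOF-ONLY (0 defs) over this lineage's `Discharge/Sec5ConstantUnitNthRoot.lean` (p442529/p443193: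
`NthRoot.hroot₁N_iff_exists_root`, `isFixedByHA_of_mul_eq`), abc-iut-f-121's `Discharge/Sec4RootTwistLaws.lean` (p438735:
`fracOfModel_twistUnit_mul`) and abc-iut-w4-d008's `Discharge/Sec5ConstEmbOfTerminal.lean` (constants pulled back from an object
`X₀` with at most one arrow from each object are `Aut_C(A)`-fixed).

THE BINDER.  In abc-iut-L2-d4's closer of record `ThetaFrobenioidTower.thetaRootPreservedAll_ofConnectedTemperoidYddFamily_final_v2`
(p448709, `Discharge/Sec5Thm57FinalKnitV2.lean`) the binder `hroot₁N` reads, for EVERY unit `u₁ ∈ O^×(B_1)` of the level-`1`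
codomain and EVERY level `N`:  ∃ `ũ ∈ O^×(B_N)` over `u₁` along `β_{1,N}` (`ũ ≫ β_{1,N} = β_{1,N} ≫ u₁`; Lemma 5.8 / Def 4.1 (iii):
an `N`-th root of the unit on `B_N`) ∧ (`hfix`) the twisted level-`1` function `s′₁·(u₁ ∘ s″₁)⁻¹` pulled back along the pull-back
factor `α′` of `α_{1,N}` is `H_{A_N}`-fixed.  It is stated at the level-`N` root REBASED over the level-`1` pair (abc-iut-f-121's
`NthRoot.rebase`, all fields `rfl`), i.e. at an `N`-th root `R̃_N = (A_N, B_N, α_{1,N}, β_{1,N}, f_N, (s′_N, s″_N))` of `(s′₁, s″₁)`.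

WHAT IS PROVED (for every `N`-th root `R` of a fraction-pair `(s′, s″) : A → B` of `f` at the canonical model setting
`mkOfModelCanonical` — hence at abc-iut-L2-t4's genuine `mkOfConnectedTemperoid(YddTower)` by `rfl` — over any rendering
`pullFrac` of the birational pull-back agreeing with `pullFracModel` (`hF`), and every unit `u ∈ O^×(B)`):
* §1–§3 (Def 4.1 (i)/(iii) bookkeeping): the twisted function is `f` divided by the pulled-back unit function `(s″)^*(u_u)`
  (`fracOf_twist_mul_pullFrac_unit`), whence — `(α′)^* f` being `H_{A_N}`-fixed by the root's own saturation clause — the `hfix`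
  clause holds IFF the pulled-back unit function `(α′)^*(s″)^*(u_u)` is `H_{A_N}`-fixed (`isFixedByHA_pullFrac_twist_iff`);
* §4 **EXACT RESIDUAL** (`NthRoot.hroot₁N_clause_iff`, under [FrdI] Thm 5.2's hypotheses `h` and `Φ` perfect — the setting's own):
  binder clause at `(u, N)` ⟺ [Lemma 5.8 at `u`: `Base(β)^*(u_u)` is an `N`-th power in `O^×(B_N^birat) = B(B_N^bs)^×`]
  ∧ [`(α′)^*(s″)^*(u_u)` is `H_{A_N}`-fixed];
* §5 **CONSTANTS** (Def 3.6 (iii) / Lemma 5.8's "`K^× ↪ O^×(B_N^birat)`" in abc-iut-w4-d008's structural form: `u_u = t^* x` for an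
  arrow `t : B^bs → X₀` into an object `X₀` receiving at most one arrow from each object — the base curve — and `x ∈ B(X₀)^×`):
  the fixedness clause HOLDS outright (`isFixedByHA_pullFrac_pullFrac_unit_of_unit_eq`); the binder clause ⟺ «`x` read on
  `B_N^bs` is an `N`-th power» (`NthRoot.hroot₁N_clause_iff_of_unit_eq`); and if `x = y^N` in `B(X₀)^×` (the constant is an
  `N`-th power of a constant) the whole clause HOLDS (`NthRoot.hroot₁N_clause_of_unit_eq_pow`);
* §6 family form over any family `(R̃_N)_N` of roots of the level-`1` pair: the closer's binder ⟺ the two pointwise clause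
  families (`hroot₁N_binder_iff_pointwise`) — instantiate `R̃_N := (R N).rebase (R 1) (α _) (β _) … (D N) (hD N)` exactly as in
  the proof of `…_final_v2` (drop-in verified on the farm: `…_final_v2` with `hroot₁N` replaced by `hsurj`/`hcfix` elaborates).
CENSUS WORDING (for the EtTh:Thm5.7 node).  `hroot₁N` = {(L58) Lemma 5.8 surjectivity "`(K^×)^{1/N}/μ_N(B_N) ⥲ K^×`" AT the
unit `u₁`, read on `B_N` — a property of the rational-function data `B₀^Λ` at `B_N^bs` (GAP row G-f123-1), not derivable from
the abstract Def 3.6 data} ∧ {(CFix) `H_{A_N}`-invariance of the unit's function — automatic for constants from the base curve}.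
NOTE ON STRENGTH: print uses these two facts only for the discrepancy unit `u` of the normalised transport (the "`u`" of the proof
of Thm 5.6, p.329; a `2l`-th root of unity by Thm 5.7 / the closer's clause (C)), whose `N`-th roots lie in `J_{lN}` (§1 p.240);
the binder as typed asks them of EVERY unit of `B_1` at EVERY level.
HONEST FRAMING: kernel-checked [FrdI]/[EtTh] §4 bookkeeping; the Lemma 5.8 input is NOT discharged here except for constants
that are `N`-th powers of base-curve constants; refereed pre-IUT material; nothing here bears on [IUTchIII] Cor. 3.12 or takes
a side; typed ≠ proved for the genuine datum.
-/

noncomputable section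

namespace Literature.AnabelianGeometry.EtaleTheta

open CategoryTheory Opposite Literature.AlgebraicGeometry.Frobenioids

/-! ## §1. Model bookkeeping: the twisted function is `f` divided by the pulled-back unit function; constants through `X₀` -/

namespace TemperedFrobenioid

universe u₀' v₀' u' v' w'

variable {D₀ : Type u₀'} [Category.{v₀'} D₀] {V : FrdIMonoidStub.{w'}} {T : RealifiedDivisorMonoids (D₀ := D₀) V}
  {D : Type u'} [Category.{v'} D] {VD : FrdICatStub.{u', v', w'} D} (C : TemperedFrobenioid T D VD)

/-- **The twisted function at the model** (Def 4.1 (i); [FrdI] Thm 5.2 (ii)): for a pair `s′, s″ : A → B` and a unit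
`u ∈ O^×(B)`, `s′·(u ∘ s″)⁻¹ · (s″)^*(u_u) = s′·(s″)⁻¹` in `O^×(A^birat) = B(A_D)^×`, the pulled-back unit function written as
`pullFracModel s″` of `u_u ∈ B(B_D)^×` (abc-iut-f-121's `fracOfModel_twistUnit_mul`, re-keyed).
[cite: MochizukiEtTh2009, Def 4.1 (i) p.312 (PDF p.86)] -/
theorem fracOfModel_twist_mul_pullFracModel_unit {A B : C.category} (s' s'' : A ⟶ B) (u : Aut B)
    (hu : u ∈ ModelFrobenioid.units B) :
    C.fracOfModel T.isUnit_BΛ s' (s'' ≫ u.hom) *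
        C.pullFracModel s'' (C.isUnit_ratFnFunctor T.isUnit_BΛ B (ModelFrobenioid.unit u.hom)).unit =
      C.fracOfModel T.isUnit_BΛ s' s'' := by
  have hc : C.pullFracModel s'' (C.isUnit_ratFnFunctor T.isUnit_BΛ B (ModelFrobenioid.unit u.hom)).unit =
      (C.isUnit_ratFnFunctor T.isUnit_BΛ A
        (pull C.ratFnFunctor (ModelFrobenioid.baseMap s'') (ModelFrobenioid.unit u.hom))).unit :=
    Units.ext rfl
  rw [hc]
  exact C.fracOfModel_twistUnit_mul T.isUnit_BΛ s' s'' u hu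

/-- `((ψ ≫ φ)^birat)^* = (ψ^birat)^* ∘ (φ^birat)^*` on `O^×(−^birat) = B(−)^×` (`B` is a functor; [FrdI] Prop 1.11 (iv) at the
model). [cite: MochizukiEtTh2009, Prop 4.2 (iii) p.314 (PDF p.88)] -/
theorem pullFracModel_pullFracModel {A A' A'' : C.category} (φ : A' ⟶ A) (ψ : A'' ⟶ A') (x : C.biratUnitsModel A) :
    C.pullFracModel ψ (C.pullFracModel φ x) = C.pullFracModel (ψ ≫ φ) x := by
  ext
  rw [coe_pullFracModel_apply, coe_pullFracModel_apply, coe_pullFracModel_apply, ModelFrobenioid.baseMap_comp]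
  exact C.ratFnFunctor_map_apply_map_apply (ModelFrobenioid.baseMap φ) (ModelFrobenioid.baseMap ψ) x

/-- If the function `u_u` of a unit `u ∈ O^×(B)` is pulled back from `X₀` along `t_B : B_D → X₀` (`u_u = t_B^* x`), then
`(s^birat)^*(u_u) = (Base(s) ≫ t_B)^* x` for any `s : A → B` (Def 3.6 (iii): constants as rational functions).
[cite: MochizukiEtTh2009, Def 3.6 (iii) p.303 (PDF p.77)] -/
theorem pullFracModel_unit_eq_unitsMap_of_unit_eq {X₀ : D} {A B : C.category} (s : A ⟶ B) (u : Aut B)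
    (tB : B.base ⟶ X₀) (x : (C.ratFnFunctor.obj (op X₀))ˣ)
    (hux : ModelFrobenioid.unit u.hom = (C.ratFnFunctor.map tB.op).hom (x : C.ratFnFunctor.obj (op X₀))) :
    C.pullFracModel s (C.isUnit_ratFnFunctor T.isUnit_BΛ B (ModelFrobenioid.unit u.hom)).unit =
      Units.map (C.ratFnFunctor.map (ModelFrobenioid.baseMap s ≫ tB).op).hom x := by
  ext
  rw [coe_pullFracModel_apply, IsUnit.unit_spec, hux, Units.coe_map]
  exact C.ratFnFunctor_map_apply_map_apply tB (ModelFrobenioid.baseMap s) x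

/-- **Constants from the base curve are fixed by every automorphism** (Def 3.6 (iii) / Lemma 5.8, abc-iut-w4-d008's
`biratAutModel_unitsMap_apply_of_subsingleton`): if `X₀` receives at most one arrow from each object and `u_u = t_B^* x`, then the
function `(φ^birat)^*(s^birat)^*(u_u) ∈ O^×(A′^birat)` is fixed by the natural action of every `σ ∈ Aut_C(A′)`.
[cite: MochizukiEtTh2009, Def 3.6 (iii) p.303 (PDF p.77); Lem 5.8 p.331 (PDF p.105)] -/
theorem biratAutModel_pullFracModel_unit_of_unit_eq {X₀ : D} (hX₀ : ∀ Y : D, Subsingleton (Y ⟶ X₀))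
    {A A' B : C.category} (s : A ⟶ B) (φ : A' ⟶ A) (u : Aut B) (tB : B.base ⟶ X₀)
    (x : (C.ratFnFunctor.obj (op X₀))ˣ)
    (hux : ModelFrobenioid.unit u.hom = (C.ratFnFunctor.map tB.op).hom (x : C.ratFnFunctor.obj (op X₀)))
    (σ : Aut A') :
    C.biratAutModel A' σ
        (C.pullFracModel φ (C.pullFracModel s (C.isUnit_ratFnFunctor T.isUnit_BΛ B (ModelFrobenioid.unit u.hom)).unit)) =
      C.pullFracModel φ (C.pullFracModel s (C.isUnit_ratFnFunctor T.isUnit_BΛ B (ModelFrobenioid.unit u.hom)).unit) := by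
  haveI := hX₀ A'.base
  rw [C.pullFracModel_pullFracModel, C.pullFracModel_unit_eq_unitsMap_of_unit_eq (φ ≫ s) u tB x hux]
  exact C.biratAutModel_unitsMap_apply_of_subsingleton A' _ σ x

/-- **Lemma 5.8's `(K^×)^{1/N} ⊆ O^×(B_N^birat)` for an `N`-th power of a base-curve constant**: if `u_u = t_B^*(y^N)` with
`y ∈ B(X₀)^×`, then along any `β : B_N → B` the function `Base(β)^*(u_u)` is the `N`-th power of `(Base(β) ≫ t_B)^* y ∈ B(B_{N,D})^×`.
[cite: MochizukiEtTh2009, Lem 5.8 p.331 (PDF p.105)] -/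
theorem exists_pow_eq_map_unit_of_unit_eq_pow {X₀ : D} {B BN : C.category} (β : BN ⟶ B) (u : Aut B)
    (tB : B.base ⟶ X₀) (y : (C.ratFnFunctor.obj (op X₀))ˣ) (N : ℕ)
    (huy : ModelFrobenioid.unit u.hom = (C.ratFnFunctor.map tB.op).hom ((y : C.ratFnFunctor.obj (op X₀)) ^ N)) :
    ∃ r : C.biratUnitsModel BN, (r : C.ratFnFunctor.obj (op BN.base)) ^ N =
      (C.ratFnFunctor.map (ModelFrobenioid.baseMap β).op).hom (ModelFrobenioid.unit u.hom) := by
  refine ⟨Units.map (C.ratFnFunctor.map (ModelFrobenioid.baseMap β ≫ tB).op).hom y, ?_⟩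
  rw [Units.coe_map, ← map_pow, huy]
  exact (C.ratFnFunctor_map_apply_map_apply tB (ModelFrobenioid.baseMap β) _).symm

end TemperedFrobenioid

namespace BiKummerSetting

universe u₀ v₀ u v w

variable {K : Type u₀} [Field K] {D₀ : Type u₀} [Category.{v₀} D₀] {V : FrdIMonoidStub.{w}}
  (X : SemiGraphs.TemperedArithmeticGroup.{u₀} K) {T : RealifiedDivisorMonoids (D₀ := D₀) V}
  {D : Type u} [Category.{v} D] {VD : FrdICatStub.{u, v, w} D}
  (tf : TemperedFrobenioid T D VD) (hZ : tf.monoidType = MonoidType.Z)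
  (hP : ∀ A : Dᵒᵖ, IsPerfect (tf.Φ.carrier A)) (IG : D → Prop) (gS : ∀ A : D, IG A → (X.Pi →* Aut A))
  (gSs : ∀ (A : D) (h : IG A), Function.Surjective (gS A h))
  (NH : Subgroup (Field.absoluteGaloisGroup K) → tf.category → ℕ+ → Prop) (A₀ : tf.category)
  (hA₀ : PreFrobenioid.IsFrobeniusTrivial tf.toElem A₀) (hA₀' : IG A₀.base)

/-! ## §2. The twisted function at the canonical model setting, through any rendering `pullFrac` of the pull-back -/

/-- **§2. The twisted function at the canonical model setting**, through any rendering `pullFrac` of the birational pull-back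
agreeing with `pullFracModel` (`hF`): for a fraction-pair `P = (s′, s″)` of `f` and a unit `u ∈ O^×(B)`,
`s′·(u ∘ s″)⁻¹ · pullFrac s″ (u_u) = f` in `O^×(A^birat)`.  [cite: MochizukiEtTh2009, Def 4.1 (i) p.312 (PDF p.86)] -/
theorem fracOf_twist_mul_pullFrac_unit {A B : tf.category}
    {pullFrac : ∀ {A A' : (mkOfModelCanonical X tf hZ hP IG gS gSs NH A₀ hA₀ hA₀').C} (_ : A' ⟶ A),
      (mkOfModelCanonical X tf hZ hP IG gS gSs NH A₀ hA₀ hA₀').biratUnits A →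
        (mkOfModelCanonical X tf hZ hP IG gS gSs NH A₀ hA₀ hA₀').biratUnits A'}
    (hF : ∀ {A A' : (mkOfModelCanonical X tf hZ hP IG gS gSs NH A₀ hA₀ hA₀').C} (ψ : A' ⟶ A)
      (y : (mkOfModelCanonical X tf hZ hP IG gS gSs NH A₀ hA₀ hA₀').biratUnits A), pullFrac ψ y = tf.pullFracModel ψ y)
    {f : (mkOfModelCanonical X tf hZ hP IG gS gSs NH A₀ hA₀ hA₀').biratUnits A}
    (P : (mkOfModelCanonical X tf hZ hP IG gS gSs NH A₀ hA₀ hA₀').FractionPair f B) (u : Aut B)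
    (hu : u ∈ (mkOfModelCanonical X tf hZ hP IG gS gSs NH A₀ hA₀ hA₀').units B) :
    (mkOfModelCanonical X tf hZ hP IG gS gSs NH A₀ hA₀ hA₀').fracOf P.num (P.den ≫ u.hom) P.isPreStep_num
        ((mkOfModelCanonical X tf hZ hP IG gS gSs NH A₀ hA₀ hA₀').isPreStep_comp_aut P.isPreStep_den u)
        ((mkOfModelCanonical X tf hZ hP IG gS gSs NH A₀ hA₀ hA₀').baseEquivalent_comp_unit P.base_eq hu) *
      pullFrac P.den (tf.isUnit_ratFnFunctor T.isUnit_BΛ B (ModelFrobenioid.unit u.hom)).unit = f := by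
  rw [hF]
  exact (tf.fracOfModel_twist_mul_pullFracModel_unit P.num P.den u hu).trans P.frac_eq


/-! ## §3. The `hfix` clause ⟺ `H`-fixedness of the pulled-back unit function -/

/-- **§3. The `hfix` clause ⟺ fixedness of the pulled-back unit function** (Def 4.1 (iii)): for `φ : A′ → A` with
`pullFrac φ f` fixed by `H_{A′}` (for a root: its own saturation clause), the twisted function `pullFrac φ (s′·(u ∘ s″)⁻¹)` is
`H_{A′}`-fixed IFF `pullFrac φ (pullFrac s″ (u_u))` is — `Aut_C(A′)` acts by group automorphisms (this lineage's §5 of p443193).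
[cite: MochizukiEtTh2009, Def 4.1 (iii) p.313 (PDF p.87)] -/
theorem isFixedByHA_pullFrac_twist_iff {A A' B : tf.category}
    {pullFrac : ∀ {A A' : (mkOfModelCanonical X tf hZ hP IG gS gSs NH A₀ hA₀ hA₀').C} (_ : A' ⟶ A),
      (mkOfModelCanonical X tf hZ hP IG gS gSs NH A₀ hA₀ hA₀').biratUnits A →
        (mkOfModelCanonical X tf hZ hP IG gS gSs NH A₀ hA₀ hA₀').biratUnits A'}
    (hF : ∀ {A A' : (mkOfModelCanonical X tf hZ hP IG gS gSs NH A₀ hA₀ hA₀').C} (ψ : A' ⟶ A)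
      (y : (mkOfModelCanonical X tf hZ hP IG gS gSs NH A₀ hA₀ hA₀').biratUnits A), pullFrac ψ y = tf.pullFracModel ψ y)
    {f : (mkOfModelCanonical X tf hZ hP IG gS gSs NH A₀ hA₀ hA₀').biratUnits A}
    (P : (mkOfModelCanonical X tf hZ hP IG gS gSs NH A₀ hA₀ hA₀').FractionPair f B) (u : Aut B)
    (hu : u ∈ (mkOfModelCanonical X tf hZ hP IG gS gSs NH A₀ hA₀ hA₀').units B) (φ : A' ⟶ A)
    (hA' : (mkOfModelCanonical X tf hZ hP IG gS gSs NH A₀ hA₀ hA₀').IsGalois A')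
    (hf : (mkOfModelCanonical X tf hZ hP IG gS gSs NH A₀ hA₀ hA₀').IsFixedByHA A' hA' (pullFrac φ f)) :
    (mkOfModelCanonical X tf hZ hP IG gS gSs NH A₀ hA₀ hA₀').IsFixedByHA A' hA'
        (pullFrac φ ((mkOfModelCanonical X tf hZ hP IG gS gSs NH A₀ hA₀ hA₀').fracOf P.num (P.den ≫ u.hom)
          P.isPreStep_num ((mkOfModelCanonical X tf hZ hP IG gS gSs NH A₀ hA₀ hA₀').isPreStep_comp_aut P.isPreStep_den u)
          ((mkOfModelCanonical X tf hZ hP IG gS gSs NH A₀ hA₀ hA₀').baseEquivalent_comp_unit P.base_eq hu))) ↔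
      (mkOfModelCanonical X tf hZ hP IG gS gSs NH A₀ hA₀ hA₀').IsFixedByHA A' hA'
        (pullFrac φ (pullFrac P.den (tf.isUnit_ratFnFunctor T.isUnit_BΛ B (ModelFrobenioid.unit u.hom)).unit)) := by
  have hmul : pullFrac φ ((mkOfModelCanonical X tf hZ hP IG gS gSs NH A₀ hA₀ hA₀').fracOf P.num (P.den ≫ u.hom)
        P.isPreStep_num ((mkOfModelCanonical X tf hZ hP IG gS gSs NH A₀ hA₀ hA₀').isPreStep_comp_aut P.isPreStep_den u)
        ((mkOfModelCanonical X tf hZ hP IG gS gSs NH A₀ hA₀ hA₀').baseEquivalent_comp_unit P.base_eq hu)) *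
      pullFrac φ (pullFrac P.den (tf.isUnit_ratFnFunctor T.isUnit_BΛ B (ModelFrobenioid.unit u.hom)).unit) = pullFrac φ f := by
    have key := fracOf_twist_mul_pullFrac_unit X tf hZ hP IG gS gSs NH A₀ hA₀ hA₀' hF P u hu
    rw [hF φ, hF φ, hF φ]
    exact ((map_mul (tf.pullFracModel φ) _ _).symm.trans (congrArg (tf.pullFracModel φ) key))
  constructor
  · intro h'
    rw [eq_inv_mul_of_mul_eq hmul]
    exact h'.inv.mul hf
  · intro hc
    exact isFixedByHA_of_mul_eq hmul hf hc


/-! ## §4. The binder `hroot₁N` of the Thm 5.7 closer at an `N`-th root, pointwise in the unit: the EXACT residual -/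

/-- **§4. EXACT RESIDUAL of the binder `hroot₁N` at an `N`-th root `R = (A_N, B_N, α = α″ ≫ α′, β, f_N, (s′_N, s″_N))` of
`(s′, s″)` and a unit `u ∈ O^×(B)`** (under [FrdI] Thm 5.2's hypotheses `h` and `Φ` perfect — the genuine setting's own):
(∃ `ũ ∈ O^×(B_N)` with `ũ ≫ β = β ≫ u` ∧ the twisted function `(α′)^*(s′·(u ∘ s″)⁻¹)` is `H_{A_N}`-fixed) ⟺
(`Base(β)^*(u_u)` is an `N`-th power in `O^×(B_N^birat) = B(B_N^bs)^×` — Lemma 5.8 "`(K^×)^{1/N}/μ_N(B_N) ⥲ K^×`" AT `u`)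
∧ (`(α′)^*(s″)^*(u_u)` is `H_{A_N}`-fixed — Def 3.6 (iii) for the unit's function).  The first equivalence is this lineage's
`NthRoot.hroot₁N_iff_exists_root` (p442529), the second `isFixedByHA_pullFrac_twist_iff` with `R`'s saturation clause.
[cite: MochizukiEtTh2009, Lem 5.8 p.331 (PDF p.105); Def 4.1 (iii) p.313 (PDF p.87)] -/
theorem NthRoot.hroot₁N_clause_iff (h : ModelFrobenioid.Hypotheses tf.divisorMonoid tf.ratFnFunctor) {A B : tf.category}
    {pullFrac : ∀ {A A' : (mkOfModelCanonical X tf hZ hP IG gS gSs NH A₀ hA₀ hA₀').C} (_ : A' ⟶ A),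
      (mkOfModelCanonical X tf hZ hP IG gS gSs NH A₀ hA₀ hA₀').biratUnits A →
        (mkOfModelCanonical X tf hZ hP IG gS gSs NH A₀ hA₀ hA₀').biratUnits A'}
    (hF : ∀ {A A' : (mkOfModelCanonical X tf hZ hP IG gS gSs NH A₀ hA₀ hA₀').C} (ψ : A' ⟶ A)
      (y : (mkOfModelCanonical X tf hZ hP IG gS gSs NH A₀ hA₀ hA₀').biratUnits A), pullFrac ψ y = tf.pullFracModel ψ y)
    {f : (mkOfModelCanonical X tf hZ hP IG gS gSs NH A₀ hA₀ hA₀').biratUnits A}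
    {P : (mkOfModelCanonical X tf hZ hP IG gS gSs NH A₀ hA₀ hA₀').FractionPair f B} {N : ℕ+}
    (R : (mkOfModelCanonical X tf hZ hP IG gS gSs NH A₀ hA₀ hA₀').NthRoot f P N pullFrac) (u : Aut B)
    (hu : u ∈ (mkOfModelCanonical X tf hZ hP IG gS gSs NH A₀ hA₀ hA₀').units B) :
    (∃ (ut : Aut R.BN) (_ : ut ∈ (mkOfModelCanonical X tf hZ hP IG gS gSs NH A₀ hA₀ hA₀').units R.BN),
        ut.hom ≫ R.β = R.β ≫ u.hom ∧
        (mkOfModelCanonical X tf hZ hP IG gS gSs NH A₀ hA₀ hA₀').IsFixedByHA R.AN R.isSaturated.isAmple.isGalois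
          (pullFrac R.αData.α₁ ((mkOfModelCanonical X tf hZ hP IG gS gSs NH A₀ hA₀ hA₀').fracOf P.num (P.den ≫ u.hom)
            P.isPreStep_num ((mkOfModelCanonical X tf hZ hP IG gS gSs NH A₀ hA₀ hA₀').isPreStep_comp_aut P.isPreStep_den u)
            ((mkOfModelCanonical X tf hZ hP IG gS gSs NH A₀ hA₀ hA₀').baseEquivalent_comp_unit P.base_eq hu)))) ↔
      (∃ r : tf.biratUnitsModel R.BN, (r : tf.ratFnFunctor.obj (op R.BN.base)) ^ (N : ℕ) =
          (tf.ratFnFunctor.map (ModelFrobenioid.baseMap R.β).op).hom (ModelFrobenioid.unit u.hom)) ∧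
        (mkOfModelCanonical X tf hZ hP IG gS gSs NH A₀ hA₀ hA₀').IsFixedByHA R.AN R.isSaturated.isAmple.isGalois
          (pullFrac R.αData.α₁ (pullFrac P.den (tf.isUnit_ratFnFunctor T.isUnit_BΛ B (ModelFrobenioid.unit u.hom)).unit)) := by
  have hfix := isFixedByHA_pullFrac_twist_iff X tf hZ hP IG gS gSs NH A₀ hA₀ hA₀' hF P u hu R.αData.α₁
    R.isSaturated.isAmple.isGalois R.isSaturated.fixed
  have hroot := NthRoot.hroot₁N_iff_exists_root h hP R u hu
  constructor
  · rintro ⟨ut, hut, hover, hc⟩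
    exact ⟨hroot.mp ⟨ut, hut, hover⟩, hfix.mp hc⟩
  · rintro ⟨hr, hc⟩
    obtain ⟨ut, hut, hover⟩ := hroot.mpr hr
    exact ⟨ut, hut, hover, hfix.mpr hc⟩

/-! ## §5. Constants pulled back from an object `X₀` with at most one arrow from each object: both clauses DISCHARGED for
`N`-th powers -/

/-- **§5. The fixedness clause DISCHARGED for base-curve constants** (Def 3.6 (iii) / Lemma 5.8): if `u_u = t_B^* x` with
`t_B : B^bs → X₀` into an object receiving at most one arrow from each object (`hX₀`; the base curve `X` in `B^temp(Π^tp_X)⁰`,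
abc-iut-w4-d008's `ConnectedPunit.subsingleton_hom`), then `pullFrac φ (pullFrac s (u_u))` is `H_{A′}`-fixed for every `s`, `φ`, `A′`.
[cite: MochizukiEtTh2009, Def 3.6 (iii) p.303 (PDF p.77); Lem 5.8 p.331 (PDF p.105)] -/
theorem isFixedByHA_pullFrac_pullFrac_unit_of_unit_eq {X₀ : D} (hX₀ : ∀ Y : D, Subsingleton (Y ⟶ X₀))
    {A A' B : tf.category}
    {pullFrac : ∀ {A A' : (mkOfModelCanonical X tf hZ hP IG gS gSs NH A₀ hA₀ hA₀').C} (_ : A' ⟶ A),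
      (mkOfModelCanonical X tf hZ hP IG gS gSs NH A₀ hA₀ hA₀').biratUnits A →
        (mkOfModelCanonical X tf hZ hP IG gS gSs NH A₀ hA₀ hA₀').biratUnits A'}
    (hF : ∀ {A A' : (mkOfModelCanonical X tf hZ hP IG gS gSs NH A₀ hA₀ hA₀').C} (ψ : A' ⟶ A)
      (y : (mkOfModelCanonical X tf hZ hP IG gS gSs NH A₀ hA₀ hA₀').biratUnits A), pullFrac ψ y = tf.pullFracModel ψ y)
    (s : A ⟶ B) (φ : A' ⟶ A) (u : Aut B) (tB : B.base ⟶ X₀) (x : (tf.ratFnFunctor.obj (op X₀))ˣ)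
    (hux : ModelFrobenioid.unit u.hom = (tf.ratFnFunctor.map tB.op).hom (x : tf.ratFnFunctor.obj (op X₀)))
    (hA' : (mkOfModelCanonical X tf hZ hP IG gS gSs NH A₀ hA₀ hA₀').IsGalois A') :
    (mkOfModelCanonical X tf hZ hP IG gS gSs NH A₀ hA₀ hA₀').IsFixedByHA A' hA'
      (pullFrac φ (pullFrac s (tf.isUnit_ratFnFunctor T.isUnit_BΛ B (ModelFrobenioid.unit u.hom)).unit)) := by
  intro σ _
  rw [hF, hF]
  exact tf.biratAutModel_pullFracModel_unit_of_unit_eq hX₀ s φ u tB x hux σ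

/-- **§5. The root clause DISCHARGED for `N`-th powers of base-curve constants**: if `u_u = t_B^*(y^N)`, `y ∈ B(X₀)^×`, then
`Base(β)^*(u_u)` is an `N`-th power in `B(B_N^bs)^×` (Lemma 5.8's `(K^×)^{1/N}` for the constant `y^N`).
[cite: MochizukiEtTh2009, Lem 5.8 p.331 (PDF p.105)] -/
theorem NthRoot.exists_root_of_unit_eq_pow {X₀ : D} {A B : tf.category}
    {pullFrac : ∀ {A A' : (mkOfModelCanonical X tf hZ hP IG gS gSs NH A₀ hA₀ hA₀').C} (_ : A' ⟶ A),
      (mkOfModelCanonical X tf hZ hP IG gS gSs NH A₀ hA₀ hA₀').biratUnits A →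
        (mkOfModelCanonical X tf hZ hP IG gS gSs NH A₀ hA₀ hA₀').biratUnits A'}
    {f : (mkOfModelCanonical X tf hZ hP IG gS gSs NH A₀ hA₀ hA₀').biratUnits A}
    {P : (mkOfModelCanonical X tf hZ hP IG gS gSs NH A₀ hA₀ hA₀').FractionPair f B} {N : ℕ+}
    (R : (mkOfModelCanonical X tf hZ hP IG gS gSs NH A₀ hA₀ hA₀').NthRoot f P N pullFrac) (u : Aut B)
    (tB : B.base ⟶ X₀) (y : (tf.ratFnFunctor.obj (op X₀))ˣ)
    (huy : ModelFrobenioid.unit u.hom = (tf.ratFnFunctor.map tB.op).hom ((y : tf.ratFnFunctor.obj (op X₀)) ^ (N : ℕ))) :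
    ∃ r : tf.biratUnitsModel R.BN, (r : tf.ratFnFunctor.obj (op R.BN.base)) ^ (N : ℕ) =
      (tf.ratFnFunctor.map (ModelFrobenioid.baseMap R.β).op).hom (ModelFrobenioid.unit u.hom) :=
  tf.exists_pow_eq_map_unit_of_unit_eq_pow R.β u tB y N huy

/-- **§5. The binder clause `hroot₁N` HOLDS at `(u, N)` for a unit whose function is the `N`-th power of a base-curve constant**
(`u_u = t_B^*(y^N)`): both halves of the §4 residual are discharged (`NthRoot.exists_root_of_unit_eq_pow`,
`isFixedByHA_pullFrac_pullFrac_unit_of_unit_eq`).  E.g. `u = 1`-type units, or a root of unity of order prime to `N` in `K'`.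
[cite: MochizukiEtTh2009, Lem 5.8 p.331 (PDF p.105); Def 4.1 (iii) p.313 (PDF p.87)] -/
theorem NthRoot.hroot₁N_clause_of_unit_eq_pow (h : ModelFrobenioid.Hypotheses tf.divisorMonoid tf.ratFnFunctor)
    {X₀ : D} (hX₀ : ∀ Y : D, Subsingleton (Y ⟶ X₀)) {A B : tf.category}
    {pullFrac : ∀ {A A' : (mkOfModelCanonical X tf hZ hP IG gS gSs NH A₀ hA₀ hA₀').C} (_ : A' ⟶ A),
      (mkOfModelCanonical X tf hZ hP IG gS gSs NH A₀ hA₀ hA₀').biratUnits A →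
        (mkOfModelCanonical X tf hZ hP IG gS gSs NH A₀ hA₀ hA₀').biratUnits A'}
    (hF : ∀ {A A' : (mkOfModelCanonical X tf hZ hP IG gS gSs NH A₀ hA₀ hA₀').C} (ψ : A' ⟶ A)
      (y : (mkOfModelCanonical X tf hZ hP IG gS gSs NH A₀ hA₀ hA₀').biratUnits A), pullFrac ψ y = tf.pullFracModel ψ y)
    {f : (mkOfModelCanonical X tf hZ hP IG gS gSs NH A₀ hA₀ hA₀').biratUnits A}
    {P : (mkOfModelCanonical X tf hZ hP IG gS gSs NH A₀ hA₀ hA₀').FractionPair f B} {N : ℕ+}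
    (R : (mkOfModelCanonical X tf hZ hP IG gS gSs NH A₀ hA₀ hA₀').NthRoot f P N pullFrac) (u : Aut B)
    (hu : u ∈ (mkOfModelCanonical X tf hZ hP IG gS gSs NH A₀ hA₀ hA₀').units B) (tB : B.base ⟶ X₀)
    (y : (tf.ratFnFunctor.obj (op X₀))ˣ)
    (huy : ModelFrobenioid.unit u.hom = (tf.ratFnFunctor.map tB.op).hom ((y : tf.ratFnFunctor.obj (op X₀)) ^ (N : ℕ))) :
    ∃ (ut : Aut R.BN) (_ : ut ∈ (mkOfModelCanonical X tf hZ hP IG gS gSs NH A₀ hA₀ hA₀').units R.BN),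
      ut.hom ≫ R.β = R.β ≫ u.hom ∧
      (mkOfModelCanonical X tf hZ hP IG gS gSs NH A₀ hA₀ hA₀').IsFixedByHA R.AN R.isSaturated.isAmple.isGalois
        (pullFrac R.αData.α₁ ((mkOfModelCanonical X tf hZ hP IG gS gSs NH A₀ hA₀ hA₀').fracOf P.num (P.den ≫ u.hom)
          P.isPreStep_num ((mkOfModelCanonical X tf hZ hP IG gS gSs NH A₀ hA₀ hA₀').isPreStep_comp_aut P.isPreStep_den u)
          ((mkOfModelCanonical X tf hZ hP IG gS gSs NH A₀ hA₀ hA₀').baseEquivalent_comp_unit P.base_eq hu))) :=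
  (NthRoot.hroot₁N_clause_iff X tf hZ hP IG gS gSs NH A₀ hA₀ hA₀' h hF R u hu).mpr
    ⟨R.exists_root_of_unit_eq_pow X tf hZ hP IG gS gSs NH A₀ hA₀ hA₀' u tB y huy,
      isFixedByHA_pullFrac_pullFrac_unit_of_unit_eq X tf hZ hP IG gS gSs NH A₀ hA₀ hA₀' hX₀ hF P.den R.αData.α₁ u tB
        (y ^ (N : ℕ)) (by rw [Units.val_pow_eq_pow_val]; exact huy) _⟩

/-- **§5. For a unit whose function is a base-curve constant `x` (`u_u = t_B^* x`), the binder clause at `(u, N)` ⟺ «`x` read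
on `B_N^bs` (along any `t_{B_N} : B_N^bs → X₀`) is an `N`-th power in `B(B_N^bs)^×`»** — Lemma 5.8's "`(K^×)^{1/N} ⊆ O^×(B_N^birat)`"
AT the constant `x`, the fixedness clause being discharged.  [cite: MochizukiEtTh2009, Lem 5.8 p.331 (PDF p.105)] -/
theorem NthRoot.hroot₁N_clause_iff_of_unit_eq (h : ModelFrobenioid.Hypotheses tf.divisorMonoid tf.ratFnFunctor)
    {X₀ : D} (hX₀ : ∀ Y : D, Subsingleton (Y ⟶ X₀)) {A B : tf.category}
    {pullFrac : ∀ {A A' : (mkOfModelCanonical X tf hZ hP IG gS gSs NH A₀ hA₀ hA₀').C} (_ : A' ⟶ A),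
      (mkOfModelCanonical X tf hZ hP IG gS gSs NH A₀ hA₀ hA₀').biratUnits A →
        (mkOfModelCanonical X tf hZ hP IG gS gSs NH A₀ hA₀ hA₀').biratUnits A'}
    (hF : ∀ {A A' : (mkOfModelCanonical X tf hZ hP IG gS gSs NH A₀ hA₀ hA₀').C} (ψ : A' ⟶ A)
      (y : (mkOfModelCanonical X tf hZ hP IG gS gSs NH A₀ hA₀ hA₀').biratUnits A), pullFrac ψ y = tf.pullFracModel ψ y)
    {f : (mkOfModelCanonical X tf hZ hP IG gS gSs NH A₀ hA₀ hA₀').biratUnits A}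
    {P : (mkOfModelCanonical X tf hZ hP IG gS gSs NH A₀ hA₀ hA₀').FractionPair f B} {N : ℕ+}
    (R : (mkOfModelCanonical X tf hZ hP IG gS gSs NH A₀ hA₀ hA₀').NthRoot f P N pullFrac) (u : Aut B)
    (hu : u ∈ (mkOfModelCanonical X tf hZ hP IG gS gSs NH A₀ hA₀ hA₀').units B) (tB : B.base ⟶ X₀)
    (tBN : R.BN.base ⟶ X₀) (x : (tf.ratFnFunctor.obj (op X₀))ˣ)
    (hux : ModelFrobenioid.unit u.hom = (tf.ratFnFunctor.map tB.op).hom (x : tf.ratFnFunctor.obj (op X₀))) :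
    (∃ (ut : Aut R.BN) (_ : ut ∈ (mkOfModelCanonical X tf hZ hP IG gS gSs NH A₀ hA₀ hA₀').units R.BN),
        ut.hom ≫ R.β = R.β ≫ u.hom ∧
        (mkOfModelCanonical X tf hZ hP IG gS gSs NH A₀ hA₀ hA₀').IsFixedByHA R.AN R.isSaturated.isAmple.isGalois
          (pullFrac R.αData.α₁ ((mkOfModelCanonical X tf hZ hP IG gS gSs NH A₀ hA₀ hA₀').fracOf P.num (P.den ≫ u.hom)
            P.isPreStep_num ((mkOfModelCanonical X tf hZ hP IG gS gSs NH A₀ hA₀ hA₀').isPreStep_comp_aut P.isPreStep_den u)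
            ((mkOfModelCanonical X tf hZ hP IG gS gSs NH A₀ hA₀ hA₀').baseEquivalent_comp_unit P.base_eq hu)))) ↔
      ∃ r : tf.biratUnitsModel R.BN, (r : tf.ratFnFunctor.obj (op R.BN.base)) ^ (N : ℕ) =
        (tf.ratFnFunctor.map tBN.op).hom (x : tf.ratFnFunctor.obj (op X₀)) := by
  haveI := hX₀ R.BN.base
  have hr : (tf.ratFnFunctor.map (ModelFrobenioid.baseMap R.β).op).hom (ModelFrobenioid.unit u.hom) =
      (tf.ratFnFunctor.map tBN.op).hom (x : tf.ratFnFunctor.obj (op X₀)) := by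
    rw [hux]
    exact tf.ratFnFunctor_map_apply_map_apply_of_subsingleton tB tBN (ModelFrobenioid.baseMap R.β) _
  rw [NthRoot.hroot₁N_clause_iff X tf hZ hP IG gS gSs NH A₀ hA₀ hA₀' h hF R u hu, hr]
  exact and_iff_left (isFixedByHA_pullFrac_pullFrac_unit_of_unit_eq X tf hZ hP IG gS gSs NH A₀ hA₀ hA₀' hX₀ hF P.den
    R.αData.α₁ u tB x hux _)

/-! ## §6. Family form: the closer's binder `hroot₁N` (all units `u₁` of the level-`1` codomain, all levels) from / iff the
two pointwise clauses -/

/-- **§6. Family form — the closer's binder is EXACTLY the two pointwise clause families.**  For any family `(R̃_N)_N` of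
`N`-th roots of ONE level-`1` pair `(s′₁, s″₁) : A_1 → B_1` of `f_1` (for abc-iut-L2-d4's `…_final_v2`: `R̃_N := (R N).rebase (R 1)
(α (one_dvd_level N)) (β (one_dvd_level N)) … (D N) (hD N)`, so that `R̃_N.β = β_{1,N}`, `R̃_N.αData = D N`, `R̃_N.AN = A_N`,
`R̃_N.BN = B_N` by `rfl`), the binder `hroot₁N` (all `u₁ ∈ O^×(B_1)`, all `N`) holds IFF (L58) every `Base(β_{1,N})^*(u_{u₁})` is an
`N`-th power in `B(B_N^bs)^×` AND (CFix) every `(D_N.α₁)^*(s″₁)^*(u_{u₁})` is `H_{A_N}`-fixed.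
[cite: MochizukiEtTh2009, Lem 5.8 p.331 (PDF p.105); Rmk 4.3.2 p.318–319 (PDF pp.92–93)] -/
theorem hroot₁N_binder_iff_pointwise (h : ModelFrobenioid.Hypotheses tf.divisorMonoid tf.ratFnFunctor)
    {A₁ B₁ : tf.category}
    {pullFrac : ∀ {A A' : (mkOfModelCanonical X tf hZ hP IG gS gSs NH A₀ hA₀ hA₀').C} (_ : A' ⟶ A),
      (mkOfModelCanonical X tf hZ hP IG gS gSs NH A₀ hA₀ hA₀').biratUnits A →
        (mkOfModelCanonical X tf hZ hP IG gS gSs NH A₀ hA₀ hA₀').biratUnits A'}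
    (hF : ∀ {A A' : (mkOfModelCanonical X tf hZ hP IG gS gSs NH A₀ hA₀ hA₀').C} (ψ : A' ⟶ A)
      (y : (mkOfModelCanonical X tf hZ hP IG gS gSs NH A₀ hA₀ hA₀').biratUnits A), pullFrac ψ y = tf.pullFracModel ψ y)
    {f₁ : (mkOfModelCanonical X tf hZ hP IG gS gSs NH A₀ hA₀ hA₀').biratUnits A₁}
    {P₁ : (mkOfModelCanonical X tf hZ hP IG gS gSs NH A₀ hA₀ hA₀').FractionPair f₁ B₁}
    (Rt : ∀ N : ℕ+, (mkOfModelCanonical X tf hZ hP IG gS gSs NH A₀ hA₀ hA₀').NthRoot f₁ P₁ N pullFrac) :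
    (∀ (u₁ : Aut B₁) (hu₁ : u₁ ∈ (mkOfModelCanonical X tf hZ hP IG gS gSs NH A₀ hA₀ hA₀').units B₁) (N : ℕ+),
        ∃ (ut : Aut (Rt N).BN) (_ : ut ∈ (mkOfModelCanonical X tf hZ hP IG gS gSs NH A₀ hA₀ hA₀').units (Rt N).BN),
        ut.hom ≫ (Rt N).β = (Rt N).β ≫ u₁.hom ∧
        (mkOfModelCanonical X tf hZ hP IG gS gSs NH A₀ hA₀ hA₀').IsFixedByHA (Rt N).AN (Rt N).isSaturated.isAmple.isGalois
          (pullFrac (Rt N).αData.α₁ ((mkOfModelCanonical X tf hZ hP IG gS gSs NH A₀ hA₀ hA₀').fracOf P₁.num (P₁.den ≫ u₁.hom)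
            P₁.isPreStep_num ((mkOfModelCanonical X tf hZ hP IG gS gSs NH A₀ hA₀ hA₀').isPreStep_comp_aut P₁.isPreStep_den u₁)
            ((mkOfModelCanonical X tf hZ hP IG gS gSs NH A₀ hA₀ hA₀').baseEquivalent_comp_unit P₁.base_eq hu₁)))) ↔
      (∀ (u₁ : Aut B₁) (_ : u₁ ∈ (mkOfModelCanonical X tf hZ hP IG gS gSs NH A₀ hA₀ hA₀').units B₁) (N : ℕ+),
        ∃ r : tf.biratUnitsModel (Rt N).BN, (r : tf.ratFnFunctor.obj (op (Rt N).BN.base)) ^ (N : ℕ) =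
          (tf.ratFnFunctor.map (ModelFrobenioid.baseMap (Rt N).β).op).hom (ModelFrobenioid.unit u₁.hom)) ∧
      (∀ (u₁ : Aut B₁) (_ : u₁ ∈ (mkOfModelCanonical X tf hZ hP IG gS gSs NH A₀ hA₀ hA₀').units B₁) (N : ℕ+),
        (mkOfModelCanonical X tf hZ hP IG gS gSs NH A₀ hA₀ hA₀').IsFixedByHA (Rt N).AN (Rt N).isSaturated.isAmple.isGalois
          (pullFrac (Rt N).αData.α₁
            (pullFrac P₁.den (tf.isUnit_ratFnFunctor T.isUnit_BΛ B₁ (ModelFrobenioid.unit u₁.hom)).unit))) := by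
  constructor
  · intro H
    exact ⟨fun u₁ hu₁ N => ((NthRoot.hroot₁N_clause_iff X tf hZ hP IG gS gSs NH A₀ hA₀ hA₀' h hF (Rt N) u₁ hu₁).mp
        (H u₁ hu₁ N)).1,
      fun u₁ hu₁ N => ((NthRoot.hroot₁N_clause_iff X tf hZ hP IG gS gSs NH A₀ hA₀ hA₀' h hF (Rt N) u₁ hu₁).mp
        (H u₁ hu₁ N)).2⟩
  · rintro ⟨hsurj, hcfix⟩ u₁ hu₁ N
    exact (NthRoot.hroot₁N_clause_iff X tf hZ hP IG gS gSs NH A₀ hA₀ hA₀' h hF (Rt N) u₁ hu₁).mpr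
      ⟨hsurj u₁ hu₁ N, hcfix u₁ hu₁ N⟩

end BiKummerSetting

end Literature.AnabelianGeometry.EtaleTheta

end
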